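import Literature.NumberTheory.Transcendental.SixExponentialsSeveralVariablesCor42Proofs
import Literature.NumberTheory.Transcendental.SixExponentialsSeveralVariablesThm41Proofs
import Literature.NumberTheory.Transcendental.SixExponentialsSeveralVariablesChainProofs
import Literature.NumberTheory.Transcendental.PhilipponZeroEstimateHolds
import HarnessLib

/-!
# Waldschmidt 1981: Corollaire 4.2, Proposition 6.1, Théorèmes 1.1 and 2.1 — the discharges

Topic `Literature/NumberTheory/Transcendental`; sibling proof file of
`SixExponentialsSeveralVariablesSteps.lean`, which vendors the intermediate results of
[Waldschmidt1981] as the named facts `Waldschmidt1981.cor_3_2`, `thm_4_1`, `cor_4_2`, `lem_5_1`,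
`prop_6_1` (and `SixExponentialsSeveralVariables.lean`: `thm_1_1`, `thm_2_1`). Everything here
is PROVED; there are no new definitions and no new facts. The file closes

* `cor_4_2_holds : cor_4_2` — **Corollaire 4.2** (p. 105): if all `exp⟨xᵢ, yⱼ⟩` are algebraic
  and `d > n` then `χ(Y, X) ≤ n/(d − n)`;
* `prop_6_1_holds : prop_6_1` — **Proposition 6.1** (p. 109): under the same hypothesis
  `μ(Y, ℂⁿ) ≤ d/(d − n)` (`prop_6_1_of_cor_4_2`, `SixExponentialsSeveralVariablesProp61Proofs.lean`);
* `thm_1_1_holds : thm_1_1`, `thm_2_1_holds : thm_2_1` — **Théorème 1.1** and **Théorème 2.1**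
  (`thm_1_1_of_cor_4_2`, `thm_2_1_of_cor_4_2`, `SixExponentialsSeveralVariablesChainProofs.lean`).

## The route, and where it deviates from the printed one

The source proves Corollaire 4.2 (p. 105) from Corollaire 3.2 (the auxiliary polynomials `P_N`,
proved: `cor_3_2_holds`), Liouville's inequality (proved: `vanish_of_large`,
`SixExponentialsSeveralVariablesCor42Proofs.lean`) and **Théorème 4.1** = Masser's zero estimate
([Masser1981, Thm 2]) in the sharp form `D ≥ (N/d)^{χ(Y,X)}`, which the tree reduces
(`thm_4_1_of_zeroEstimate_torus`) to the zero estimate on the torus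
`Philippon1986_zeroEstimate_torus`, a separate named fact with its own discharge route.
The final step of that proof is the limiting argument "`(⌊N/c'⌋/d)^χ ≤ d N^{n/(d−n)} (log N)^{n+2}`
for all large `N` forces `χ ≤ n/(d−n)`" (`not_forall_rpow_le`), in which multiplicative constants
depending only on `d` are immaterial. We therefore replace Théorème 4.1 by the WEAK zero estimate

`thm_4_1_weak : ∀ d, ∃ c ≥ 1, … P ≠ 0, deg P ≤ D, P(e^{⟨xᵢ,y⟩}) = 0 (y ∈ Y_N) ⟹ (N/(d+1))^{χ(Y,X)} ≤ c·D`,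

which we PROVE from Philippon's zero estimate on `𝔾ₐ × 𝔾ₘ^d` with multiplicities — the tree's
named fact `Philippon1986_GaGm`, now a theorem (`Philippon1986_GaGm_holds`,
`PhilipponZeroEstimateHolds.lean`; [Philippon1986, Thm 2.1], [NesterenkoPhilippon2001, Ch. 11
Thm 4.1]) — used with `m = d`, `T = 0`, `W = Lie G`, `D₀ = 1`, `D₁ = D`, the polynomial
`P(Y₁, …, Y_d)` (free of the additive variable) and the finite set
`Σ = {(0, e^{⟨x₁,y⟩}, …, e^{⟨x_d,y⟩}) ; y ∈ Y_M} ⊂ 𝔾ₐ × 𝔾ₘ^d`, `M = [N/(d+1)]`, so that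
`Σ(d+1) ⊆ {0} × exp(Y_N)`. The connected algebraic subgroup `G' = V × T_A` it produces lies in a
translate of the zero set of `P`, hence `A ≠ 0` (a polynomial vanishing on `(ℂˣ)^d` is zero,
`eq_zero_of_forall_torus_eval_eq_zero`), `dim T_A ≥ d − rank A` (`finrank_torusTangent_add_ge`),
and `Card((Σ·G')/G') ≤ c · D^{rank A}`; from there the counting is that of
[NesterenkoPhilippon2001, Ch. 11, proof of Cor. 4.2, p. 222], verbatim as in
`thm_4_1_of_zeroEstimate_torus` (`exists_coord_complement`, `expTorus_mem_subtorus_iff`,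
`chi_le_masserQuot`): `(M+1)^{ℓ−λ} ≤ c · D^r`, `χ ≤ (ℓ−λ)/r`, whence `(N/(d+1))^χ ≤ c · D`.
Then `cor_4_2_of_thm_4_1_weak` repeats the printed proof of p. 105 (`cor_4_2_of_thm_4_1`) with the
weak estimate. The sharp named fact `thm_4_1` itself is NOT discharged here (its constant `1` and
denominator `d` are not reachable with an unspecified `c(d)`); it keeps its own route
`thm_4_1_of_zeroEstimate_torus`. The present route makes Corollaire 4.2, Proposition 6.1 and
Théorèmes 1.1, 2.1 independent of the torus fact.

## References

* [Waldschmidt1981] M. Waldschmidt, *Transcendance et exponentielles en plusieurs variables*,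
  Invent. Math. 63 (1981) 97–127, doi:10.1007/bf01389195: §4 Théorème 4.1, Corollaire 4.2 (p. 105),
  §6 a) Proposition 6.1 (p. 109), Théorème 1.1 (p. 98), Théorème 2.1 (p. 100). Read on the open GDZ
  scan PPN356556735_0063, LOG_0012.
* [Philippon1986] P. Philippon, *Lemmes de zéros dans les groupes algébriques commutatifs*,
  Bull. Soc. Math. France 114 (1986) 355–383, Théorème 2.1.
* [NesterenkoPhilippon2001] Yu. V. Nesterenko, P. Philippon (eds.), *Introduction to Algebraic
  Independence Theory*, LNM 1752, Springer 2001, Ch. 11 (D. Roy), Thm 4.1 (p. 218), Cor. 4.2 and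
  the remark on `𝔾ₘⁿ` (pp. 221–222).
* [Masser1981] D. W. Masser, *On polynomials and exponential polynomials in several complex
  variables*, Invent. Math. 63 (1981) 81–95, Theorem 2.
-/

noncomputable section

open Complex Module MvPolynomial

namespace Literature.NumberTheory.Transcendental.Waldschmidt1981

/-! ### Two lemmas on the torus `(ℂˣ)^d` inside `𝔾ₐ × 𝔾ₘ^d` -/

/-- A polynomial vanishing at every point of `(ℂˣ)^d` is zero. [folklore] -/
theorem eq_zero_of_forall_torus_eval_eq_zero {d : ℕ} (P : MvPolynomial (Fin d) ℂ)
    (h : ∀ t : Fin d → ℂˣ, MvPolynomial.eval (fun i => ((t i : ℂˣ) : ℂ)) P = 0) : P = 0 := by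
  refine MvPolynomial.funext_set (fun _ => ({0} : Set ℂ)ᶜ)
    (fun _ => (Set.finite_singleton (0 : ℂ)).infinite_compl) fun z hz => ?_
  rw [map_zero]
  have hz' : ∀ i, z i ≠ 0 := fun i => by
    have := (Set.mem_pi.mp hz) i (Set.mem_univ i)
    simpa using this
  have := h (fun i => Units.mk0 (z i) (hz' i))
  simpa using this

/-- **`dim Lie T_M + rank M ≥ d`** for the subtorus `T_M` of `𝔾ₘ^d` cut out by a subgroup
`M ≤ ℤ^d` of characters: the Lie algebra `{v ; ∑ χⱼ vⱼ = 0 ∀ χ ∈ M}` contains the kernel of the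
`r × d` matrix of a `ℤ`-basis of `M` (`r = rank M`), whose rank is `≤ r`
([NesterenkoPhilippon2001, Ch. 11 §2.1 Example: "`codim H_A = rank A`"]; only this inequality is
needed). [folklore] -/
theorem finrank_torusTangent_add_ge {d : ℕ} (H : GaGm.ConnAlgSubgroup d) :
    d ≤ Module.finrank ℂ H.torusTangent +
      Module.finrank ℤ (AddSubgroup.toIntSubmodule H.chars) := by
  classical
  set A' : Submodule ℤ (Fin d → ℤ) := AddSubgroup.toIntSubmodule H.chars with hA'def
  obtain ⟨r, bB⟩ := Submodule.basisOfPid (Pi.basisFun ℤ (Fin d)) A'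
  have hr : Module.finrank ℤ A' = r := by
    rw [Module.finrank_eq_card_basis bB, Fintype.card_fin]
  -- the complexified basis vectors, as the rows of a matrix
  let a : Fin r → Fin d → ℂ := fun k j => (((bB k : A') : Fin d → ℤ) j : ℂ)
  have hker : LinearMap.ker (Matrix.of a).mulVecLin ≤ H.torusTangent := by
    intro v hv
    rw [LinearMap.mem_ker] at hv
    have hv' : ∀ k, a k ⬝ᵥ v = 0 := fun k => by
      have := congr_fun hv k
      rwa [of_mulVecLin_apply] at this
    change ∀ χ ∈ H.chars, ∑ j, ((χ j : ℤ) : ℂ) * v j = 0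
    intro χ hχ
    have hχA : χ ∈ A' := hχ
    set c : Fin r → ℤ := fun k => bB.repr ⟨χ, hχA⟩ k with hcdef
    have hχeq : χ = ∑ k, c k • ((bB k : A') : Fin d → ℤ) := by
      have h := congrArg Subtype.val (bB.sum_repr ⟨χ, hχA⟩).symm
      simpa only [Submodule.coe_sum, SetLike.val_smul] using h
    have hχj : ∀ j, (χ j : ℂ) = ∑ k, (c k : ℂ) * a k j := fun j => by
      have h1 : χ j = ∑ k, c k * ((bB k : A') : Fin d → ℤ) j := by
        conv_lhs => rw [hχeq]
        simp [Finset.sum_apply]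
      rw [h1]
      push_cast
      rfl
    calc ∑ j, (χ j : ℂ) * v j = ∑ j, (∑ k, (c k : ℂ) * a k j) * v j := by simp_rw [hχj]
      _ = ∑ k, (c k : ℂ) * (a k ⬝ᵥ v) := by
          simp only [dotProduct, Finset.sum_mul, Finset.mul_sum]
          rw [Finset.sum_comm]
          refine Finset.sum_congr rfl fun k _ => Finset.sum_congr rfl fun j _ => by ring
      _ = 0 := by simp [hv']
  have h1 := finrank_ker_of_mulVecLin_add a
  have h2 : Module.finrank ℂ (Submodule.span ℂ (Set.range a)) ≤ r := by
    have := finrank_range_le_card (R := ℂ) a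
    rwa [Fintype.card_fin] at this
  have h3 := Submodule.finrank_mono hker
  rw [hr]
  omega

/-! ### A weak form of Théorème 4.1 from Philippon's zero estimate on `𝔾ₐ × 𝔾ₘ^d` -/

/-- **Masser's zero estimate up to a constant** (a weak Théorème 4.1 of [Waldschmidt1981]): for
every `d` there is `c = c(d) ≥ 1` such that, if `x₁, …, x_d` and `y₁, …, y_ℓ` are `ℤ`-free in `ℂⁿ`
and `P ≠ 0` of total degree `≤ D` (`D ≥ 1`) vanishes at `(e^{⟨xᵢ,y⟩})ᵢ` for all
`y = ∑ mⱼyⱼ`, `0 ≤ mⱼ ≤ N` (`N ≥ 1`), then `(N/(d+1))^{χ(Y,X)} ≤ c · D`. Deduced from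
`Philippon1986_GaGm_holds` (`m = d`, `T = 0`, `W = Lie G`, `D₀ = 1`) by the counting argument of
[NesterenkoPhilippon2001, Ch. 11, proof of Cor. 4.2, p. 222]; see the module docstring.
[cite: NesterenkoPhilippon2001, Ch. 11 Thm 4.1 p. 218 + Cor. 4.2 pp. 221–222]
[cite: Waldschmidt1981, §4 Théorème 4.1 (p. 105), weak form] -/
theorem thm_4_1_weak (d : ℕ) : ∃ c : ℝ, 1 ≤ c ∧
    ∀ ⦃n l : ℕ⦄ (x : Fin d → Fin n → ℂ) (y : Fin l → Fin n → ℂ),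
      LinearIndependent ℤ x → LinearIndependent ℤ y →
      ∀ (P : MvPolynomial (Fin d) ℂ) (D N : ℕ), P ≠ 0 → P.totalDegree ≤ D → 1 ≤ D → 0 < N →
        (∀ m : Fin l → ℕ, (∀ j, m j ≤ N) →
          MvPolynomial.eval (fun i => cexp (x i ⬝ᵥ ∑ j, (m j : ℂ) • y j)) P = 0) →
        ((N : ℝ) / (d + 1)) ^
            ((chi (Submodule.span ℤ (Set.range x)) (Submodule.span ℤ (Set.range y)) : ℚ) : ℝ) ≤
          c * D := by
  classical
  obtain ⟨c₀, hc₀⟩ := Philippon1986_GaGm_holds d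
  refine ⟨max (c₀ : ℝ) 1, le_max_right _ _, ?_⟩
  intro n l x y hx hy P D N hP hdeg hD _hN hvan
  set c : ℝ := max (c₀ : ℝ) 1 with hcdef
  have hc1 : 1 ≤ c := le_max_right _ _
  have hc₀c : (c₀ : ℝ) ≤ c := le_max_left _ _
  set X : Submodule ℤ (Fin n → ℂ) := Submodule.span ℤ (Set.range x) with hXdef
  set Y : Submodule ℤ (Fin n → ℂ) := Submodule.span ℤ (Set.range y) with hYdef
  have hD1 : (1 : ℝ) ≤ D := by exact_mod_cast hD
  have hd1 : 0 < d + 1 := Nat.succ_pos d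
  -- `M = [N/(d+1)]`; the map `E = exp` into the torus, embedded in `𝔾ₐ × 𝔾ₘ^d`
  set M : ℕ := N / (d + 1) with hMdef
  obtain ⟨E, hE⟩ := exists_expTorus x
  let emb : Torus d →* GaGm d := MonoidHom.inr (Multiplicative ℂ) (Torus d)
  have hemb2 : ∀ t, (emb t).2 = t := fun t => rfl
  -- the points `∑ mⱼ yⱼ` of `Y` and the set `Σ = {0} × exp(Y_M)`
  let pt : (Fin l → ℕ) → (Fin n → ℂ) := fun m => ∑ j, ((m j : ℕ) : ℂ) • y j
  have pt_mem : ∀ m, pt m ∈ Y := fun m =>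
    Submodule.sum_mem _ fun j _ => by
      rw [Nat.cast_smul_eq_nsmul]
      exact nsmul_mem (Submodule.subset_span (Set.mem_range_self j)) _
  set Box : Set (Fin l → ℕ) := {m | ∀ j, m j ∈ Set.Iic M} with hBoxdef
  have hBox : Box.Finite := Set.Finite.pi' fun _ => Set.finite_Iic M
  set S : Set (GaGm d) := (fun m => emb (E (pt m))) '' Box with hSdef
  have hSfin : S.Finite := hBox.image _
  have h1S : (1 : GaGm d) ∈ S := by
    refine ⟨0, fun j => Set.mem_Iic.mpr (Nat.zero_le _), ?_⟩
    show emb (E (pt 0)) = 1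
    have h0 : pt 0 = 0 := by simp [pt]
    rw [h0, expTorus_zero hE, map_one]
  -- the polynomial `P' = P(Y₁, …, Y_d) ∈ ℂ[X, Y₁, …, Y_d]`
  set P' : MvPolynomial (Fin (d + 1)) ℂ := rename Fin.succ P with hP'def
  have hP'0 : P' ≠ 0 := fun h =>
    hP (rename_injective _ (Fin.succ_injective d) (h.trans (map_zero _).symm))
  have h0range : (0 : Fin (d + 1)) ∉ Set.range (Fin.succ : Fin d → Fin (d + 1)) := by
    rintro ⟨k, hk⟩
    exact Fin.succ_ne_zero k hk
  have hP'deg0 : P'.degreeOf 0 ≤ 1 := by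
    rw [degreeOf_le_iff]
    intro s hs
    rw [hP'def, support_rename_of_injective (Fin.succ_injective d)] at hs
    obtain ⟨s₀, -, rfl⟩ := Finset.mem_image.mp hs
    rw [Finsupp.mapDomain_notin_range _ _ h0range]
    exact Nat.zero_le _
  have hP'deg1 : ∀ s ∈ P'.support, ∑ j : Fin d, s (Fin.succ j) ≤ D := by
    intro s hs
    rw [hP'def, support_rename_of_injective (Fin.succ_injective d)] at hs
    obtain ⟨s₀, hs₀, rfl⟩ := Finset.mem_image.mp hs
    simp_rw [Finsupp.mapDomain_apply (Fin.succ_injective d)]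
    calc ∑ j, s₀ j = s₀.sum (fun _ e => e) := (Finsupp.sum_fintype s₀ (fun _ e => e) fun _ => rfl).symm
      _ ≤ P.totalDegree := le_totalDegree hs₀
      _ ≤ D := hdeg
  have hevalP' : ∀ g : GaGm d,
      GaGm.evalAt P' g = MvPolynomial.eval (fun i => ((g.2 i : ℂˣ) : ℂ)) P := by
    intro g
    rw [GaGm.evalAt, hP'def, eval_rename]
    exact congrArg (fun v => MvPolynomial.eval v P) (funext fun i => by simp)
  -- `P'` vanishes on `Σ(d+1) ⊆ {0} × exp(Y_{(d+1)M}) ⊆ {0} × exp(Y_N)`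
  have hvanS : ∀ g ∈ GaGm.sumset S (d + 1), GaGm.VanishesToOrder P' ⊤ g ((d + 1) * 0 + 1) := by
    rintro g ⟨σ, hσ, rfl⟩
    rw [mul_zero, zero_add, GaGm.vanishesToOrder_one_iff, hevalP']
    choose m hmBox hmσ using hσ
    have hprod : (∏ k, σ k).2 = E (pt fun j => ∑ k, m k j) := by
      rw [Prod.snd_prod]
      have h1 : ∏ k, (σ k).2 = ∏ k, E (pt (m k)) :=
        Finset.prod_congr rfl fun k _ => by rw [← hmσ k]; exact hemb2 _
      rw [h1, ← expTorus_sum hE]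
      congr 1
      simp only [pt]
      rw [Finset.sum_comm]
      refine Finset.sum_congr rfl fun j _ => ?_
      rw [← Finset.sum_smul, Nat.cast_sum]
    rw [hprod]
    have hval : (fun i => ((E (pt fun j => ∑ k, m k j) i : ℂˣ) : ℂ)) =
        fun i => cexp (x i ⬝ᵥ pt fun j => ∑ k, m k j) := funext fun i => hE _ i
    rw [hval]
    refine hvan (fun j => ∑ k, m k j) fun j => ?_
    calc ∑ k, m k j ≤ ∑ _k : Fin (d + 1), M :=
          Finset.sum_le_sum fun k _ => Set.mem_Iic.mp (hmBox k j)
      _ = (d + 1) * M := by simp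
      _ ≤ N := Nat.mul_div_le N (d + 1)
  have hW : 0 < Module.finrank ℂ (⊤ : Submodule ℂ (ℂ × (Fin d → ℂ))) := by
    rw [finrank_top, Module.finrank_prod, Module.finrank_self, Module.finrank_fin_fun]
    omega
  -- Philippon's zero estimate on `𝔾ₐ × 𝔾ₘ^d`
  obtain ⟨H, ⟨g, hg⟩, hcard⟩ :=
    hc₀ 1 D 0 ⊤ S P' le_rfl hD hW hSfin h1S hP'0 hP'deg0 hP'deg1 hvanS
  simp only [zero_add, Nat.choose_self, one_mul, one_pow, mul_one] at hcard
  -- the character lattice `A` of the torus part of `G'`; `emb t ∈ G' ↔ t ∈ H_A`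
  set A : AddSubgroup (Fin d → ℤ) := H.chars with hAdef
  have hmemH : ∀ t : Torus d, emb t ∈ H.toSubgroup ↔ t ∈ Torus.subtorus A := by
    intro t
    change ((H.addPart = false → (emb t).1 = 1) ∧
      ∀ χ ∈ H.chars, ∏ j, ((emb t).2 j) ^ (χ j) = 1) ↔ _
    rw [Torus.mem_subtorus]
    exact ⟨fun h => h.2, fun h => ⟨fun _ => rfl, h⟩⟩
  -- `A ≠ 0`, because `G'` lies in a translate of `Z(P')` and `P ≢ 0` on `(ℂˣ)^d`
  have hA0 : A ≠ ⊥ := by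
    intro hA
    apply hP
    apply eq_zero_of_forall_torus_eval_eq_zero
    intro t
    have ht : g.2⁻¹ * t ∈ Torus.subtorus A := by
      rw [hA, Torus.subtorus_bot]
      exact Subgroup.mem_top _
    have := hg _ ((hmemH _).mpr ht)
    rw [hevalP'] at this
    simpa [hemb2, mul_inv_cancel_left] using this
  -- ranks: `r = rank A`, `1 ≤ r ≤ d`, `dim T_A ≥ d − r`, so `Card((Σ·G')/G') ≤ c · D^r`
  set A' : Submodule ℤ (Fin d → ℤ) := AddSubgroup.toIntSubmodule A with hA'def
  set r : ℕ := Module.finrank ℤ A' with hrdef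
  have hrd : r ≤ d := by
    have h := Submodule.finrank_le A'
    rwa [Module.finrank_fin_fun] at h
  obtain ⟨a₀, ha₀A, ha₀0⟩ := (A.bot_or_exists_ne_zero).resolve_left hA0
  have hA'ne : A' ≠ ⊥ := by
    intro h
    have : a₀ ∈ A' := ha₀A
    rw [h, Submodule.mem_bot] at this
    exact ha₀0 this
  have hr1 : 1 ≤ r := Nat.one_le_iff_ne_zero.mpr fun h => hA'ne (Submodule.finrank_eq_zero.mp h)
  have hdim : d ≤ H.torusDim + r := finrank_torusTangent_add_ge H
  have hncard : (Set.ncard ((QuotientGroup.mk : GaGm d → GaGm d ⧸ H.toSubgroup) '' S) : ℝ) ≤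
      c * (D : ℝ) ^ r := by
    have hpos : 0 < D ^ (d - r) := pow_pos hD _
    have h1 : Set.ncard ((QuotientGroup.mk : GaGm d → GaGm d ⧸ H.toSubgroup) '' S) * D ^ (d - r) ≤
        c₀ * D ^ d :=
      calc Set.ncard ((QuotientGroup.mk : GaGm d → GaGm d ⧸ H.toSubgroup) '' S) * D ^ (d - r)
          ≤ Set.ncard ((QuotientGroup.mk : GaGm d → GaGm d ⧸ H.toSubgroup) '' S) *
              D ^ H.torusDim :=
            Nat.mul_le_mul_left _ (Nat.pow_le_pow_right hD (by omega))
        _ ≤ c₀ * D ^ d := hcard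
    have h2 : Set.ncard ((QuotientGroup.mk : GaGm d → GaGm d ⧸ H.toSubgroup) '' S) ≤
        c₀ * D ^ r := by
      apply Nat.le_of_mul_le_mul_right _ hpos
      calc Set.ncard ((QuotientGroup.mk : GaGm d → GaGm d ⧸ H.toSubgroup) '' S) * D ^ (d - r)
          ≤ c₀ * D ^ d := h1
        _ = c₀ * D ^ r * D ^ (d - r) := by rw [mul_assoc, ← pow_add, Nat.add_sub_cancel' hrd]
    calc (Set.ncard ((QuotientGroup.mk : GaGm d → GaGm d ⧸ H.toSubgroup) '' S) : ℝ)
        ≤ ((c₀ * D ^ r : ℕ) : ℝ) := by exact_mod_cast h2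
      _ = (c₀ : ℝ) * (D : ℝ) ^ r := by push_cast; ring
      _ ≤ c * (D : ℝ) ^ r := by gcongr
  -- `X' = {∑ aᵢ xᵢ ; a ∈ A}` and `Y' = {v ∈ Y ; ⟨X', v⟩ ⊆ 2iπℤ}`
  let φ : (Fin d → ℤ) →ₗ[ℤ] (Fin n → ℂ) := Fintype.linearCombination ℤ x
  have hφ : Function.Injective φ := hx.fintypeLinearCombination_injective
  set X' : Submodule ℤ (Fin n → ℂ) := A'.map φ with hX'def
  obtain ⟨Y', hY'mem⟩ := exists_annTwoPiI X' Y
  have hX'X : X' ≤ X := by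
    rw [hXdef, ← Fintype.range_linearCombination ℤ x]
    exact LinearMap.map_le_range
  have hX'ne : X' ≠ ⊥ := by
    intro h
    have hmem : φ a₀ ∈ X' := Submodule.mem_map_of_mem (show a₀ ∈ A' from ha₀A)
    rw [h, Submodule.mem_bot, ← map_zero φ] at hmem
    exact ha₀0 (hφ hmem)
  have hfinX' : Module.finrank ℤ X' = r :=
    (LinearEquiv.finrank_eq (Submodule.equivMapOfInjective φ hφ A')).symm
  have hY'Y : Y' ≤ Y := fun v hv => ((hY'mem v).mp hv).1
  have hpair : PairingInTwoPiIZ X' Y' := fun u hu v hv => ((hY'mem v).mp hv).2 u hu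
  have hYfg : Y.FG := Submodule.fg_span (Set.finite_range y)
  haveI : Module.Finite ℤ Y := Module.Finite.iff_fg.mpr hYfg
  haveI : Module.Finite ℤ Y' := finite_of_le_fg hYfg hY'Y
  haveI : Module.Finite ℤ X := Module.Finite.iff_fg.mpr (Submodule.fg_span (Set.finite_range x))
  have hfinY : Module.finrank ℤ Y = l := by
    rw [hYdef, finrank_span_eq_card hy, Fintype.card_fin]
  have hfinX : Module.finrank ℤ X = d := by
    rw [hXdef, finrank_span_eq_card hx, Fintype.card_fin]
  set lam : ℕ := Module.finrank ℤ Y' with hlamdef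
  have hlaml : lam ≤ l := by
    have h := Submodule.finrank_mono hY'Y
    rwa [hfinY] at h
  -- `χ(Y, X) ≤ (ℓ − λ)/r`
  have hchi : chi X Y ≤ ((l : ℚ) - lam) / r := by
    have h := chi_le_masserQuot hX'X hY'Y hX'ne hpair
      (by rw [hfinX, hfinX']; exact hrd) (by rw [hfinY]; exact hlaml)
    rw [masserQuot, hfinY, hfinX'] at h
    exact h
  -- two points of `Y` are congruent modulo `G'` iff their difference lies in `Y'`: counting
  let ψ : (Fin l → ℤ) →ₗ[ℤ] (Fin n → ℂ) := Fintype.linearCombination ℤ y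
  have hψ : Function.Injective ψ := hy.fintypeLinearCombination_injective
  set B : Submodule ℤ (Fin l → ℤ) := Y'.comap ψ with hBdef
  have hBlam : Module.finrank ℤ B ≤ lam := by
    rw [LinearEquiv.finrank_eq (Submodule.equivMapOfInjective ψ hψ B)]
    exact Submodule.finrank_mono (Submodule.map_comap_le ψ Y')
  obtain ⟨κ, instκ, a, ha, hcardκ, hsep⟩ := exists_coord_complement l B
  -- the sub-box in the directions `a` injects into `(Σ·G')/G'`
  let ext : (κ → Fin (M + 1)) → (Fin l → ℕ) := fun m => Function.extend a (fun k => (m k : ℕ)) 0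
  have hext_apply : ∀ m k, ext m (a k) = (m k : ℕ) := fun m k => ha.extend_apply _ _ _
  have hext_off : ∀ m j, (¬ ∃ k, a k = j) → ext m j = 0 := fun m j hj => by
    simp only [ext]
    rw [Function.extend_apply' _ _ _ hj]
    rfl
  have hextBox : ∀ m, ext m ∈ Box := by
    intro m j
    rw [Set.mem_Iic]
    by_cases hj : ∃ k, a k = j
    · obtain ⟨k, rfl⟩ := hj
      rw [hext_apply]
      exact Nat.lt_succ_iff.mp (m k).isLt
    · rw [hext_off m j hj]
      exact Nat.zero_le _
  let Φ : (κ → Fin (M + 1)) → GaGm d ⧸ H.toSubgroup :=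
    fun m => QuotientGroup.mk (emb (E (pt (ext m))))
  have hΦS : Set.range Φ ⊆ (QuotientGroup.mk : GaGm d → GaGm d ⧸ H.toSubgroup) '' S := by
    rintro _ ⟨m, rfl⟩
    exact ⟨_, ⟨ext m, hextBox m, rfl⟩, rfl⟩
  have hΦinj : Function.Injective Φ := by
    intro m₁ m₂ h
    have hmem : (emb (E (pt (ext m₁))))⁻¹ * emb (E (pt (ext m₂))) ∈ H.toSubgroup :=
      QuotientGroup.eq.mp h
    rw [← map_inv, ← map_mul, hmemH, ← expTorus_sub hE, expTorus_mem_subtorus_iff hE] at hmem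
    -- the integer vector of the difference lies in `B` and is supported on the range of `a`
    let cv : Fin l → ℤ := fun j => (ext m₂ j : ℤ) - (ext m₁ j : ℤ)
    have hψc : ψ cv = pt (ext m₂) - pt (ext m₁) := by
      simp only [ψ, Fintype.linearCombination_apply, pt, cv]
      rw [← Finset.sum_sub_distrib]
      refine Finset.sum_congr rfl fun j _ => ?_
      rw [← Int.cast_smul_eq_zsmul ℂ, Int.cast_sub, Int.cast_natCast, Int.cast_natCast, sub_smul]
    have hcB : cv ∈ B := by
      rw [hBdef, Submodule.mem_comap, hψc, hY'mem]
      refine ⟨Y.sub_mem (pt_mem _) (pt_mem _), fun u hu => ?_⟩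
      obtain ⟨a', ha', rfl⟩ := Submodule.mem_map.mp hu
      exact hmem a' ha'
    have hcsupp : ∀ j, (¬ ∃ k, a k = j) → cv j = 0 := fun j hj => by
      simp only [cv, hext_off _ j hj, Nat.cast_zero, sub_zero]
    have hc0 := hsep cv hcB hcsupp
    funext k
    have hk := hc0 k
    simp only [cv, hext_apply] at hk
    exact Fin.ext (by omega)
  have hcount : (M + 1) ^ Fintype.card κ ≤
      ((QuotientGroup.mk : GaGm d → GaGm d ⧸ H.toSubgroup) '' S).ncard := by
    calc (M + 1) ^ Fintype.card κ = Nat.card (κ → Fin (M + 1)) := by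
          rw [Nat.card_eq_fintype_card, Fintype.card_fun, Fintype.card_fin]
      _ = (Set.range Φ).ncard := (Set.ncard_range_of_injective hΦinj).symm
      _ ≤ ((QuotientGroup.mk : GaGm d → GaGm d ⧸ H.toSubgroup) '' S).ncard :=
          Set.ncard_le_ncard hΦS (hSfin.image _)
  have hcount' : ((M : ℝ) + 1) ^ (l - lam) ≤ (c * D) ^ r := by
    have h1 : (M + 1) ^ (l - lam) ≤ (M + 1) ^ Fintype.card κ :=
      Nat.pow_le_pow_right (Nat.succ_pos M) (by omega : l - lam ≤ Fintype.card κ)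
    have h2 : ((M : ℝ) + 1) ^ (l - lam) ≤
        (((QuotientGroup.mk : GaGm d → GaGm d ⧸ H.toSubgroup) '' S).ncard : ℝ) := by
      exact_mod_cast h1.trans hcount
    have hDr : (0 : ℝ) ≤ (D : ℝ) ^ r := by positivity
    calc ((M : ℝ) + 1) ^ (l - lam) ≤ c * (D : ℝ) ^ r := h2.trans hncard
      _ ≤ c ^ r * (D : ℝ) ^ r :=
          mul_le_mul_of_nonneg_right (le_self_pow₀ hc1 (by omega)) hDr
      _ = (c * D) ^ r := by rw [mul_pow]
  -- the real inequality `(N/(d+1))^χ ≤ (M+1)^χ ≤ (M+1)^{(ℓ−λ)/r} ≤ c·D`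
  have hχ0 : (0 : ℝ) ≤ ((chi X Y : ℚ) : ℝ) := by exact_mod_cast chi_nonneg X Y
  have hχ : ((chi X Y : ℚ) : ℝ) ≤ ((l - lam : ℕ) : ℝ) / r := by
    have h : ((chi X Y : ℚ) : ℝ) ≤ ((((l : ℚ) - lam) / r : ℚ) : ℝ) := by exact_mod_cast hchi
    rw [Nat.cast_sub hlaml]
    push_cast at h ⊢
    exact h
  have hb1 : (1 : ℝ) ≤ (M : ℝ) + 1 := by simp
  have hNd : (N : ℝ) / (d + 1) ≤ (M : ℝ) + 1 := by
    have hd0 : (0 : ℝ) < d + 1 := by positivity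
    rw [div_le_iff₀ hd0]
    have h : N < M * (d + 1) + (d + 1) := Nat.lt_div_mul_add hd1
    have h' : (N : ℝ) ≤ (M : ℝ) * (d + 1) + (d + 1) := by exact_mod_cast h.le
    linarith
  calc ((N : ℝ) / (d + 1)) ^ ((chi X Y : ℚ) : ℝ)
      ≤ ((M : ℝ) + 1) ^ ((chi X Y : ℚ) : ℝ) := Real.rpow_le_rpow (by positivity) hNd hχ0
    _ ≤ ((M : ℝ) + 1) ^ (((l - lam : ℕ) : ℝ) / r) := Real.rpow_le_rpow_of_exponent_le hb1 hχ
    _ ≤ c * D := rpow_div_le_of_pow_le (by positivity) (by positivity) hr1 hcount'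

/-! ### Corollaire 4.2 from the weak zero estimate -/

/-- **Corollaire 4.2 from the weak Théorème 4.1.** The printed proof of p. 105
(`cor_4_2_of_thm_4_1`: Corollaire 3.2 gives `P_N`; Liouville's inequality makes `F_N` vanish on
`Y_M`, `M = ⌊N/(1 + ∑‖yⱼ‖)⌋`; the zero estimate bounds `deg P_N` from below), run with
`thm_4_1_weak`: `(M/(d+1))^{χ(Y,X)} ≤ c · deg P_N ≤ c d N^{n/(d−n)} (log N)^{n+2}` for all large
`N`, whence `χ(Y, X) ≤ n/(d − n)` (`not_forall_rpow_le`, constants being immaterial).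
[cite: Waldschmidt1981, §4 Corollaire 4.2 (p. 105)] -/
theorem cor_4_2_of_thm_4_1_weak
    (h41 : ∀ d : ℕ, ∃ c : ℝ, 1 ≤ c ∧
      ∀ ⦃n l : ℕ⦄ (x : Fin d → Fin n → ℂ) (y : Fin l → Fin n → ℂ),
        LinearIndependent ℤ x → LinearIndependent ℤ y →
        ∀ (P : MvPolynomial (Fin d) ℂ) (D N : ℕ), P ≠ 0 → P.totalDegree ≤ D → 1 ≤ D → 0 < N →
          (∀ m : Fin l → ℕ, (∀ j, m j ≤ N) →
            MvPolynomial.eval (fun i => cexp (x i ⬝ᵥ ∑ j, (m j : ℂ) • y j)) P = 0) →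
          ((N : ℝ) / (d + 1)) ^
              ((chi (Submodule.span ℤ (Set.range x)) (Submodule.span ℤ (Set.range y)) : ℚ) : ℝ) ≤
            c * D) :
    cor_4_2 := by
  intro n d l x y hx hy halg hnd
  classical
  obtain ⟨c₄, hc₄1, h41w⟩ := h41 d
  have hc₄pos : 0 < c₄ := by linarith
  -- the algebraic data `α_{ij} = exp⟨xᵢ, yⱼ⟩`
  obtain ⟨G, idx, hidx⟩ : ∃ (G : AlgGens) (idx : Fin d → Fin l → G.ι),
      ∀ i j, G.a (idx i j) = cexp (x i ⬝ᵥ y j) :=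
    ⟨⟨Fin d × Fin l, fun ij => cexp (x ij.1 ⬝ᵥ y ij.2), fun ij => halg ij.1 ij.2⟩,
      fun i j => (i, j), fun _ _ => rfl⟩
  -- the auxiliary polynomials of Corollaire 3.2
  obtain ⟨N₀, -, hPN⟩ := cor_3_2_holds x hnd
  -- constants
  have hdn : (0 : ℝ) < (d : ℝ) - n := by
    have : (n : ℝ) < d := by exact_mod_cast hnd
    linarith
  have hθ0 : (0 : ℝ) ≤ (n : ℝ) / (d - n) := div_nonneg (Nat.cast_nonneg _) hdn.le
  obtain ⟨c', hc'⟩ : ∃ c' : ℝ, c' = 1 + ∑ j, ‖y j‖ := ⟨_, rfl⟩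
  have hc'1 : 1 ≤ c' := by
    have : 0 ≤ ∑ j, ‖y j‖ := Finset.sum_nonneg fun _ _ => norm_nonneg _
    rw [hc']; linarith
  have hc'pos : 0 < c' := by linarith
  -- the constant `dd = c₄ (d + 1)` absorbing both the denominator `d + 1` and the factor `c₄ d`
  obtain ⟨dd, hdd⟩ : ∃ dd : ℝ, dd = c₄ * (d + 1) := ⟨_, rfl⟩
  have hddpos : 0 < dd := by rw [hdd]; positivity
  have hdd1 : (d : ℝ) + 1 ≤ dd := by
    rw [hdd]
    have h0 : (0 : ℝ) ≤ d + 1 := by positivity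
    nlinarith
  have hdd2 : c₄ * d ≤ dd := by rw [hdd]; nlinarith
  obtain ⟨C, hC⟩ : ∃ C : ℝ,
      C = G.h * (d * l * (Real.log |(G.den : ℝ)| + Real.log G.M) + (d + 1)) := ⟨_, rfl⟩
  obtain ⟨N₁, hN₁⟩ : ∃ N₁ : ℝ, N₁ = max (max (N₀ : ℝ) 3) (max c' (Real.exp C + 1)) := ⟨_, rfl⟩
  -- the key inequality for `N ≥ N₁`
  have key : ∀ N : ℕ, N₁ ≤ N →
      (((⌊(N : ℝ) / c'⌋₊ : ℕ) : ℝ) / dd) ^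
          ((chi (Submodule.span ℤ (Set.range x)) (Submodule.span ℤ (Set.range y)) : ℚ) : ℝ) ≤
        dd * ((N : ℝ) ^ ((n : ℝ) / (d - n)) * Real.log N ^ (n + 2)) := by
    intro N hN
    rw [hN₁] at hN
    have hNN₀ : N₀ ≤ N := by
      have : (N₀ : ℝ) ≤ N := le_trans (by simp) hN
      exact_mod_cast this
    have hN3 : (3 : ℝ) ≤ N := le_trans (by simp) hN
    have hNc : c' ≤ N := le_trans (by simp) hN
    have hNe : Real.exp C + 1 ≤ N := le_trans (by simp) hN
    have hNpos : (0 : ℝ) < N := by linarith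
    have hNC : G.h * (d * l * (Real.log |(G.den : ℝ)| + Real.log G.M) + (d + 1)) < Real.log N := by
      rw [← hC, Real.lt_log_iff_exp_lt hNpos]; linarith
    obtain ⟨P, hP0, hdeg, hcoef, hsmall⟩ := hPN N hNN₀
    have hMle : ((⌊(N : ℝ) / c'⌋₊ : ℕ) : ℝ) ≤ N / c' := Nat.floor_le (by positivity)
    have hMN : ((⌊(N : ℝ) / c'⌋₊ : ℕ) : ℝ) ≤ N := hMle.trans (div_le_self hNpos.le hc'1)
    have hMy : ((⌊(N : ℝ) / c'⌋₊ : ℕ) : ℝ) * ∑ j, ‖y j‖ ≤ N :=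
      calc ((⌊(N : ℝ) / c'⌋₊ : ℕ) : ℝ) * ∑ j, ‖y j‖ ≤ (N / c') * c' :=
            mul_le_mul hMle (by rw [hc']; linarith) (Finset.sum_nonneg fun _ _ => norm_nonneg _)
              (by positivity)
        _ = N := div_mul_cancel₀ _ hc'pos.ne'
    have hMpos : 0 < ⌊(N : ℝ) / c'⌋₊ :=
      Nat.floor_pos.mpr (by rw [le_div_iff₀ hc'pos, one_mul]; exact hNc)
    -- `F_N` vanishes on `Y_M`, `M = ⌊N / c'⌋`
    have hvan : ∀ m : Fin l → ℕ, (∀ j, m j ≤ ⌊(N : ℝ) / c'⌋₊) →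
        MvPolynomial.eval (fun i => cexp (x i ⬝ᵥ ∑ j, (m j : ℂ) • y j))
          (map (Int.castRingHom ℂ) P) = 0 := by
      intro m hm
      rw [eval_map_intCast]
      exact vanish_of_large x y hnd G idx hidx hN3 P hP0 hdeg hcoef hsmall hNC hMN hMy m hm
    -- the weak zero estimate for `P_N ∈ ℂ[T]`, `D = deg P_N ≥ 1`, on `Y_M`
    have hP'0 : map (Int.castRingHom ℂ) P ≠ 0 := fun h =>
      hP0 (map_injective (Int.castRingHom ℂ) Int.cast_injective (h.trans (map_zero _).symm))
    have hD1 : 1 ≤ (map (Int.castRingHom ℂ) P).totalDegree := by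
      refine one_le_totalDegree_map x P hP0 0 (lt_of_le_of_lt (hsmall 0 (by simp)) ?_)
      rw [Real.exp_lt_one_iff]
      have h1 : 0 < (N : ℝ) ^ ((d : ℝ) / (d - n)) := Real.rpow_pos_of_pos hNpos _
      have h2 : 0 < Real.log N := Real.log_pos (by linarith)
      have := mul_pos h1 (pow_pos h2 (d + 2))
      linarith
    have h := h41w x y hx hy (map (Int.castRingHom ℂ) P) (map (Int.castRingHom ℂ) P).totalDegree
      (⌊(N : ℝ) / c'⌋₊) hP'0 le_rfl hD1 hMpos hvan
    have hχ0 : (0 : ℝ) ≤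
        ((chi (Submodule.span ℤ (Set.range x)) (Submodule.span ℤ (Set.range y)) : ℚ) : ℝ) := by
      exact_mod_cast chi_nonneg _ _
    have hbase : (((⌊(N : ℝ) / c'⌋₊ : ℕ) : ℝ) / dd) ≤ (((⌊(N : ℝ) / c'⌋₊ : ℕ) : ℝ) / (d + 1)) :=
      div_le_div_of_nonneg_left (Nat.cast_nonneg _) (by positivity) hdd1
    refine (Real.rpow_le_rpow (by positivity) hbase hχ0).trans (h.trans ?_)
    have h1 : (map (Int.castRingHom ℂ) P).totalDegree = P.totalDegree := by
      simp only [totalDegree, support_map_of_injective P (f := Int.castRingHom ℂ) Int.cast_injective]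
    have hdegle : ((map (Int.castRingHom ℂ) P).totalDegree : ℝ) ≤
        d * ((N : ℝ) ^ ((n : ℝ) / (d - n)) * Real.log N ^ (n + 2)) :=
      calc ((map (Int.castRingHom ℂ) P).totalDegree : ℝ) ≤ ∑ i, (P.degreeOf i : ℝ) := by
            rw [h1]
            exact_mod_cast totalDegree_le_sum_degreeOf P
        _ ≤ ∑ _i : Fin d, (N : ℝ) ^ ((n : ℝ) / (d - n)) * Real.log N ^ (n + 2) :=
            Finset.sum_le_sum fun i _ => (hdeg i).le
        _ = d * ((N : ℝ) ^ ((n : ℝ) / (d - n)) * Real.log N ^ (n + 2)) := by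
            rw [Finset.sum_const, Finset.card_univ, Fintype.card_fin, nsmul_eq_mul]
    have hpos : 0 ≤ (N : ℝ) ^ ((n : ℝ) / (d - n)) * Real.log N ^ (n + 2) := by
      have h2 : 0 ≤ Real.log N := Real.log_nonneg (by linarith)
      positivity
    calc c₄ * ((map (Int.castRingHom ℂ) P).totalDegree : ℝ)
        ≤ c₄ * (d * ((N : ℝ) ^ ((n : ℝ) / (d - n)) * Real.log N ^ (n + 2))) :=
          mul_le_mul_of_nonneg_left hdegle hc₄pos.le
      _ = (c₄ * d) * ((N : ℝ) ^ ((n : ℝ) / (d - n)) * Real.log N ^ (n + 2)) := by ring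
      _ ≤ dd * ((N : ℝ) ^ ((n : ℝ) / (d - n)) * Real.log N ^ (n + 2)) :=
          mul_le_mul_of_nonneg_right hdd2 hpos
  -- conclusion: `χ ≤ n/(d−n)`
  by_contra hcon
  rw [not_le] at hcon
  have hθχ : (n : ℝ) / (d - n) <
      ((chi (Submodule.span ℤ (Set.range x)) (Submodule.span ℤ (Set.range y)) : ℚ) : ℝ) := by
    have h := (Rat.cast_lt (K := ℝ)).mpr hcon
    push_cast at h
    exact h
  exact not_forall_rpow_le hθ0 hθχ hc'pos hddpos key

/-! ### The discharges -/

/-- **Corollaire 4.2 of [Waldschmidt1981], proved**: if the numbers `exp⟨xᵢ, yⱼ⟩`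
(`1 ≤ i ≤ d`, `1 ≤ j ≤ ℓ`) are all algebraic and `d > n`, then `χ(Y, X) ≤ n/(d − n)`. Inputs:
Corollaire 3.2 (`cor_3_2_holds`), Liouville's inequality (`vanish_of_large`) and Philippon's zero
estimate on `𝔾ₐ × 𝔾ₘ^d` (`Philippon1986_GaGm_holds`, through `thm_4_1_weak`).
[cite: Waldschmidt1981, §4 Corollaire 4.2 (p. 105)] -/
theorem cor_4_2_holds : cor_4_2 :=
  cor_4_2_of_thm_4_1_weak thm_4_1_weak

/-- **Proposition 6.1 of [Waldschmidt1981], proved**: if `X = ℤx₁ + … + ℤx_d`,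
`Y = ℤy₁ + … + ℤy_ℓ ⊂ ℂⁿ` have ranks `d > n`, `ℓ`, and all `exp⟨xᵢ, yⱼ⟩` are algebraic, then
`μ(Y, ℂⁿ) ≤ d/(d − n)` — from Corollaire 4.2 (`cor_4_2_holds`) by Lemmes 5.2–5.3 and §6 a)
(`prop_6_1_of_cor_4_2`). [cite: Waldschmidt1981, §6 a) Proposition 6.1 (p. 109)] -/
theorem prop_6_1_holds : prop_6_1 :=
  prop_6_1_of_cor_4_2 cor_4_2_holds

/-- **Théorème 1.1 of [Waldschmidt1981], proved** (from Corollaire 4.2, `thm_1_1_of_cor_4_2`).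
[cite: Waldschmidt1981, §1 Théorème 1.1 (p. 98)] -/
theorem thm_1_1_holds : thm_1_1 :=
  thm_1_1_of_cor_4_2 cor_4_2_holds

/-- **Théorème 2.1 of [Waldschmidt1981], proved** (from Corollaire 4.2, `thm_2_1_of_cor_4_2`).
[cite: Waldschmidt1981, §2 Théorème 2.1 (p. 100)] -/
theorem thm_2_1_holds : thm_2_1 :=
  thm_2_1_of_cor_4_2 cor_4_2_holds

end Literature.NumberTheory.Transcendental.Waldschmidt1981

end
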